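import Literature.Computability.AlgebraicComplexity.FormChartDimensionCount
import Literature.Computability.AlgebraicComplexity.EquivariantDC
import Mathlib.LinearAlgebra.FiniteDimensional.Lemmas
import Mathlib.LinearAlgebra.Dimension.Constructions
import HarnessLib

/-!
# Generic forms avoid charts with an abstract linear fibre; stabilizer elements of a fixed
# conjugacy type (dimension-count criterion, every field)

Topic `Literature/Computability/AlgebraicComplexity` (cell `val-lit`, row X3-Poonen05). Theorems only —
no definition, no named fact.

The tree's `isZariskiGeneric_not_mem_chartImage` (`FormChartDimensionCount`) says: a Zariski-generic
form of degree `D` (BI 2017's "almost all `w ∈ Sym^D`", `IsZariskiGeneric`) lies outside the image of a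
polynomial chart `(p, y) ↦ G(p) · (∑_{e ∈ S} y_e x^e)` as soon as `#params + #S < N`, `N` the number of
monomials of degree `D`. For the stabilizer counts of Matsumura–Monsky 1964 (Poonen 2005 Thm. 3) over
fields of positive characteristic the linear fibre is NOT a coordinate subspace (the forms fixed by a
unipotent matrix), so this file upgrades the criterion:

* § 1 `finrank_homogeneousSubmodule_eq_card_degMonomials`, `finiteDimensional_homogeneousSubmodule`
  — `dim Sym^D K^σ = N`.
* § 2 `isZariskiGeneric_forall_map_eval_ne` — a universal form `F` with polynomial coefficients in
  fewer than `N` parameters misses almost all forms (its `N` coefficient polynomials are algebraically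
  dependent — Mathlib's transcendence degree through the tree's `exists_aeval_eq_zero_of_card_lt`);
  `isZariskiGeneric_forall_linSubst_ne_of_finrank` — the image of `(π, h) ↦ G(π) · h`, `h` in an
  ABSTRACT finite-dimensional subspace `W`, misses almost all forms when `#params + dim W < N`
  (choose a basis of `W`). The tree's `isZariskiGeneric_not_mem_chartImage` is the special case
  `W = restrictSupport K S` (forms supported on a monomial set `S`, `dim W = #S`); it is NOT re-derived
  here (no duplicate declaration — its own proof in `FormChartDimensionCount` stays the reference, and
  both rest on the same `exists_aeval_eq_zero_of_card_lt`).
* § 3 `linearIndependent_of_dual_family`, `linearIndependent_sum_of_triangular_dual_family` —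
  linear independence from a (block unitriangular) system of test functionals;
  `finrank_fixedForms_add_le_card_degMonomials` — if `r` linearly independent forms lie in the image of
  `u₀ - 1` on `Sym^D` then the forms of degree `D` fixed by `u₀` span at most `N - r` dimensions
  (rank–nullity).
* § 4 `exists_eq_linSubst_of_mul_eq_mul` — if `u · f = f` and `u P = P u₀` with `P` invertible then
  `f = P · h` with `h` fixed by `u₀`; **`isZariskiGeneric_forall_mem_linStabilizer_mul_ne`** — the
  working form of the Matsumura–Monsky count: given a polynomial matrix chart `G` in `#ι` parameters
  and a model matrix `u₀` with `#ι + dim (Sym^D)^{u₀} < N`, almost all forms `f` of degree `D` admit NO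
  stabilizer element `u` with `u G(π) = G(π) u₀`, `det G(π) ≠ 0`.

Consumers (same seat): generic ternary forms have no regular unipotent symmetry; generic forms have no
transvection symmetry (positive characteristic); Poonen 2005 Thm. 3 for plane curves. Honest framing:
classical bookkeeping (the dimension count of [MatsumuraMonsky1963] behind [Poonen2005, Thm. 3] and
[BurgisserIkenmeyer2017, §2.1]); typed ≠ endorsed; nothing here bears on VP versus VNP, which is NOT
proved.

## References

* H. Matsumura, P. Monsky, *On the automorphisms of hypersurfaces*, J. Math. Kyoto Univ. 3 (1963/64)
  347–361 (the count over conjugacy classes; not held, acq-11400). [MatsumuraMonsky1963]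
* B. Poonen, *Varieties without extra automorphisms III: hypersurfaces*, Finite Fields Appl. 11
  (2005) 230–268, Thm. 3 (p0002:L17–21). [Poonen2005]
* P. Bürgisser, C. Ikenmeyer, *Fundamental invariants of orbit closures*, J. Algebra 477 (2017), §2.1
  ("almost all `w ∈ Sym^D ℂ^m`"). [BurgisserIkenmeyer2017]

## Tree

`IsZariskiGeneric`, `formCoeff`, `degMonomials`, `DegIdx`, `mem_degMonomials_iff`
(`BI17FundamentalInvariantForms`, `OrbitCoordinateRing`); `exists_aeval_eq_zero_of_card_lt`
(`RazElusiveGeneralExistence`); `map_linSubst` (`MultiplicityObstructionsProofs`); `linSubst_mul`,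
`linSubst_one`, `linSubst_isHomogeneous`, `linStabilizer`, `mem_linStabilizer`, `linSubstRep_apply`
(`LinSubst`, `EquivariantDC`); `IsZariskiGeneric.mono'` (`GenericTrivialStabilizerAllFields`, re-proved
here privately to keep imports low).

## Provenance

Cell `val-lit`, seat `val-lit-x3` generation 9 (cross-ladder literature seat; row X3 residue).
-/

noncomputable section

open MvPolynomial

namespace Literature.Computability.AlgebraicComplexity

/-! ### § 1 `dim Sym^D K^σ = N` -/

section Finrank

variable (σ : Type*) [Fintype σ] [DecidableEq σ] (K : Type*) [Field K]

/-- `dim_K Sym^D K^σ` is the number `N` of monomials of degree `D` (the monomial basis; Poonen's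
`N = C(d+n+1, d)` coordinates on the space of degree-`d` forms, p0002:L9–12).
[cite: Poonen2005, §1 (p0002:L9–12, N = number of monomials of degree d)] -/
theorem finrank_homogeneousSubmodule_eq_card_degMonomials (D : ℕ) :
    Module.finrank K ↥(homogeneousSubmodule σ K D) = (degMonomials σ D).card := by
  classical
  let E : ↥({d : σ →₀ ℕ | d.degree = D}) ≃ ↥(degMonomials σ D) :=
    Equiv.subtypeEquivRight fun d => (mem_degMonomials_iff (σ := σ) (m := D) (d := d)).symm
  letI : Fintype ↥({d : σ →₀ ℕ | d.degree = D}) := Fintype.ofEquiv _ E.symm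
  rw [homogeneousSubmodule_eq_finsupp_supported,
    LinearEquiv.finrank_eq (AddMonoidAlgebra.supportedEquivFinsupp _),
    Module.finrank_finsupp_self, Fintype.ofEquiv_card, Fintype.card_coe]

/-- `Sym^D K^σ` is finite-dimensional for a finite set of variables `σ` (it has the `N` monomial
coordinates, p0002:L9–12). [cite: Poonen2005, §1 (p0002:L9–12, N = number of monomials of degree d)] -/
theorem finiteDimensional_homogeneousSubmodule (D : ℕ) :
    FiniteDimensional K ↥(homogeneousSubmodule σ K D) := by
  classical
  let E : ↥({d : σ →₀ ℕ | d.degree = D}) ≃ ↥(degMonomials σ D) :=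
    Equiv.subtypeEquivRight fun d => (mem_degMonomials_iff (σ := σ) (m := D) (d := d)).symm
  letI : Fintype ↥({d : σ →₀ ℕ | d.degree = D}) := Fintype.ofEquiv _ E.symm
  rw [homogeneousSubmodule_eq_finsupp_supported]
  exact Module.Finite.equiv (AddMonoidAlgebra.supportedEquivFinsupp _).symm

end Finrank

/-! ### § 2 Universal forms in few parameters miss almost all forms -/

section Universal

variable {σ : Type*} [Fintype σ] [DecidableEq σ] {K : Type*} [Field K] {ι : Type*} [Fintype ι]

/-- Copy of the tree's `IsZariskiGeneric.mono'` (a generic property implies any weaker one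
generically), kept private to avoid importing the stabilizer files here. [folklore] -/
private theorem IsZariskiGeneric.weaken {D : ℕ} {P Q : MvPolynomial σ K → Prop}
    (hP : IsZariskiGeneric D P) (hPQ : ∀ f : MvPolynomial σ K, f.IsHomogeneous D → P f → Q f) :
    IsZariskiGeneric D Q := by
  obtain ⟨F, hF0, hF⟩ := hP
  exact ⟨F, hF0, fun f hf hFf => hPQ f hf (hF f hf hFf)⟩

/-- **Universal forms in fewer than `N` parameters miss almost all forms.** If `F` is a polynomial in
the variables `σ` whose coefficients are polynomials in parameters `ι` with `#ι < N = #{monomials of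
degree D}`, then almost all forms `f` of degree `D` are not a specialisation `F(π)` of `F`: the `N`
coefficient polynomials of `F` are algebraically dependent (more polynomials than variables), and a
nonzero relation between them vanishes on every specialisation. (The dimension count of
Matsumura–Monsky behind "almost all `w ∈ Sym^D`", in polynomial-identity form.)
[cite: BurgisserIkenmeyer2017, §2.1 ("almost all w")] -/
theorem isZariskiGeneric_forall_map_eval_ne (D : ℕ) (F : MvPolynomial σ (MvPolynomial ι K))
    (hcard : Fintype.card ι < (degMonomials σ D).card) :
    IsZariskiGeneric D fun f : MvPolynomial σ K =>
      ∀ π : ι → K, MvPolynomial.map (MvPolynomial.eval π) F ≠ f := by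
  classical
  let Ψ : DegIdx σ D → MvPolynomial ι K := fun d => coeff d.1 F
  have hlt : Fintype.card ι < Fintype.card (DegIdx σ D) := by rwa [Fintype.card_coe]
  obtain ⟨Φ, hΦ0, hΦ⟩ := exists_aeval_eq_zero_of_card_lt hlt Ψ
  refine ⟨Φ, hΦ0, fun f _ hFf π hπ => hFf ?_⟩
  subst hπ
  have hcoeff : formCoeff D (MvPolynomial.map (MvPolynomial.eval π) F) = fun d => aeval π (Ψ d) := by
    funext d
    change coeff d.1 (MvPolynomial.map (MvPolynomial.eval π) F) = MvPolynomial.eval π (coeff d.1 F)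
    rw [coeff_map]
  have h2 : aeval (fun d => aeval π (Ψ d)) Φ = aeval π (aeval Ψ Φ) := by
    rw [← comp_aeval]; rfl
  rw [hcoeff, h2, hΦ, map_zero]

/-- **Charts with an abstract linear fibre miss almost all forms.** Let `G` be a square matrix of
polynomials in parameters `ι` and `W` a finite-dimensional space of polynomials with
`#ι + dim W < N = #{monomials of degree D}`. Then almost all forms `f` of degree `D` are NOT of the form
`G(π) · h` with `h ∈ W` (choose a basis `b_1, …, b_w` of `W`; the universal form
`G(X) · ∑ Y_t b_t` has `#ι + w < N` parameters). Upgrade of the tree's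
`isZariskiGeneric_not_mem_chartImage` (whose fibre is a coordinate subspace).
[cite: BurgisserIkenmeyer2017, §2.1 ("almost all w")] -/
theorem isZariskiGeneric_forall_linSubst_ne_of_finrank (D : ℕ) (G : Matrix σ σ (MvPolynomial ι K))
    (W : Submodule K (MvPolynomial σ K)) [FiniteDimensional K W]
    (hcard : Fintype.card ι + Module.finrank K W < (degMonomials σ D).card) :
    IsZariskiGeneric D fun f : MvPolynomial σ K =>
      ∀ π : ι → K, ∀ h ∈ W, linSubst σ K (G.map (MvPolynomial.eval π)) h ≠ f := by
  classical
  set n := Module.finrank K W with hn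
  let b : Module.Basis (Fin n) K W := Module.finBasis K W
  -- the universal form `G(X) · ∑_t Y_t b_t` over the parameter ring `K[X_i, Y_t]`
  let F : MvPolynomial σ (MvPolynomial (ι ⊕ Fin n) K) :=
    linSubst σ _ (G.map (rename (Sum.inl : ι → ι ⊕ Fin n)))
      (∑ t : Fin n, C (X (Sum.inr t)) * MvPolynomial.map C ((b t : W) : MvPolynomial σ K))
  have hlt : Fintype.card (ι ⊕ Fin n) < (degMonomials σ D).card := by
    rwa [Fintype.card_sum, Fintype.card_fin]
  refine (isZariskiGeneric_forall_map_eval_ne D F hlt).weaken fun f _ hF π h hh heq => ?_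
  apply hF (Sum.elim π fun t => b.repr ⟨h, hh⟩ t)
  rw [← heq, map_linSubst]
  have hG : (G.map (rename (Sum.inl : ι → ι ⊕ Fin n))).map
      (MvPolynomial.eval (Sum.elim π fun t => b.repr ⟨h, hh⟩ t)) = G.map (MvPolynomial.eval π) := by
    ext i j
    simp only [Matrix.map_apply, eval_rename, Sum.elim_comp_inl]
  have hC : (MvPolynomial.eval (Sum.elim π fun t => b.repr ⟨h, hh⟩ t)).comp C = RingHom.id K :=
    RingHom.ext fun a => eval_C _
  rw [hG, map_sum]
  congr 1
  have hsum : (∑ t, (b.repr ⟨h, hh⟩ t) • ((b t : W) : MvPolynomial σ K)) = h := by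
    have := congrArg (fun w : W => (w : MvPolynomial σ K)) (b.sum_repr ⟨h, hh⟩)
    simpa only [Submodule.coe_sum, Submodule.coe_smul] using this
  refine Eq.trans (Finset.sum_congr rfl fun t _ => ?_) hsum
  rw [map_mul, map_C, eval_X, Sum.elim_inr, map_map, hC, MvPolynomial.map_id, smul_eq_C_mul]

end Universal

/-! ### § 3 Linear independence from test functionals; the fixed forms of `u₀` -/

section DualFamily

variable {K : Type*} [Field K] {M : Type*} [AddCommGroup M] [Module K M]

/-- A family with a dual system of functionals (`φ_i (v_j) = δ_{ij}`) is linearly independent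
(linear-algebra step of the fixed-space bounds in the Matsumura–Monsky count).
[cite: Poonen2005, Thm. 3 (proof: dimension count of [MM]; linear-algebra step)] -/
theorem linearIndependent_of_dual_family {ι : Type*} [DecidableEq ι] (v : ι → M)
    (φ : ι → M →ₗ[K] K)
    (h : ∀ i j, φ i (v j) = if i = j then 1 else 0) : LinearIndependent K v := by
  rw [linearIndependent_iff']
  intro s c hs i hi
  have h0 := congrArg (φ i) hs
  rw [map_sum, map_zero] at h0
  simp only [map_smul, smul_eq_mul, h] at h0
  have h1 : ∀ y ∈ s, (c y * if i = y then (1 : K) else 0) = if i = y then c y else 0 := by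
    intro y _
    split_ifs <;> simp
  rw [Finset.sum_congr rfl h1, Finset.sum_ite_eq s i c, if_pos hi] at h0
  exact h0

/-- Block-unitriangular version: a family indexed by `ι₁ ⊕ ι₂` with functionals that are dual on each
block and such that the second block of functionals kills the first block of vectors is linearly
independent (no condition on the first functionals against the second vectors; linear-algebra step of
the fixed-space bounds in the Matsumura–Monsky count).
[cite: Poonen2005, Thm. 3 (proof: dimension count of [MM]; linear-algebra step)] -/
theorem linearIndependent_sum_of_triangular_dual_family {ι₁ ι₂ : Type*} [DecidableEq ι₁]
    [DecidableEq ι₂] (v : ι₁ ⊕ ι₂ → M)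
    (φ : ι₁ ⊕ ι₂ → M →ₗ[K] K)
    (h₁ : ∀ i j : ι₁, φ (Sum.inl i) (v (Sum.inl j)) = if i = j then 1 else 0)
    (h₂ : ∀ i j : ι₂, φ (Sum.inr i) (v (Sum.inr j)) = if i = j then 1 else 0)
    (h₂₁ : ∀ (i : ι₂) (j : ι₁), φ (Sum.inr i) (v (Sum.inl j)) = 0) : LinearIndependent K v := by
  classical
  rw [linearIndependent_iff']
  intro s c hs
  -- applying a functional `φ x` whose values on the other vectors of the sum vanish isolates `c x`
  have key : ∀ x ∈ s, (∀ y ∈ s, c y * φ x (v y) = if y = x then c y else 0) → c x = 0 := by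
    intro x hx hy
    have h0 := congrArg (φ x) hs
    rw [map_sum, map_zero] at h0
    simp only [map_smul, smul_eq_mul] at h0
    rw [Finset.sum_congr rfl hy, Finset.sum_ite_eq' s x c, if_pos hx] at h0
    exact h0
  -- first the coefficients of the second block vanish
  have hc₂ : ∀ i : ι₂, Sum.inr i ∈ s → c (Sum.inr i) = 0 := fun i hi =>
    key (Sum.inr i) hi fun y _ => by
      rcases y with j | j
      · rw [h₂₁, mul_zero, if_neg Sum.inl_ne_inr]
      · rw [h₂ i j]
        by_cases hij : i = j
        · subst hij; simp
        · rw [if_neg hij, mul_zero, if_neg fun h => hij (Sum.inr_injective h).symm]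
  -- then those of the first block
  intro x hx
  rcases x with i | i
  · refine key (Sum.inl i) hx fun y hy => ?_
    rcases y with j | j
    · rw [h₁ i j]
      by_cases hij : i = j
      · subst hij; simp
      · rw [if_neg hij, mul_zero, if_neg fun h => hij (Sum.inl_injective h).symm]
    · rw [hc₂ j hy, zero_mul, if_neg Sum.inr_ne_inl]
  · exact hc₂ i hx

end DualFamily

section FixedForms

variable {σ : Type*} [Fintype σ] [DecidableEq σ] {K : Type*} [Field K]

/-- **Rank–nullity bound for the fixed forms of `u₀`.** If `r` forms `v_i` of degree `D` have
linearly independent images `u₀ · v_i - v_i`, then the space `(Sym^D)^{u₀}` of forms of degree `D`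
fixed by the linear substitution `u₀` has dimension at most `N - r` (the bound
`dim (Sym^D)^{u₀} ≤ N - rank(u₀ - 1)` used class by class in the Matsumura–Monsky count).
[cite: Poonen2005, Thm. 3 (proof: dimension count of [MM]; fixed forms of a class)] -/
theorem finrank_fixedForms_add_card_le_card_degMonomials (D : ℕ) (u₀ : Matrix σ σ K)
    {r : Type*} [Fintype r] (v : r → MvPolynomial σ K) (hv : ∀ i, (v i).IsHomogeneous D)
    (hli : LinearIndependent K fun i => linSubst σ K u₀ (v i) - v i) :
    Module.finrank K ↥(homogeneousSubmodule σ K D ⊓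
        LinearMap.ker ((linSubst σ K u₀).toLinearMap - LinearMap.id)) + Fintype.card r ≤
      (degMonomials σ D).card := by
  classical
  haveI := finiteDimensional_homogeneousSubmodule σ K D
  set V : Submodule K (MvPolynomial σ K) := homogeneousSubmodule σ K D with hV
  set L : MvPolynomial σ K →ₗ[K] MvPolynomial σ K :=
    (linSubst σ K u₀).toLinearMap - LinearMap.id with hL
  let φ : ↥V →ₗ[K] MvPolynomial σ K := L.domRestrict V
  -- rank–nullity on `φ`
  have hrn := LinearMap.finrank_range_add_finrank_ker φ
  have hVN : Module.finrank K ↥V = (degMonomials σ D).card :=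
    finrank_homogeneousSubmodule_eq_card_degMonomials σ K D
  rw [hVN] at hrn
  -- `ker φ ≅ V ⊓ ker L`
  have hker : Module.finrank K ↥(LinearMap.ker φ) = Module.finrank K ↥(V ⊓ LinearMap.ker L) := by
    have hk : LinearMap.ker φ = Submodule.comap V.subtype (LinearMap.ker L) := by
      ext x
      simp only [φ, LinearMap.mem_ker, LinearMap.domRestrict_apply, Submodule.mem_comap,
        Submodule.subtype_apply]
    rw [hk, ← Submodule.finrank_map_subtype_eq V (Submodule.comap V.subtype (LinearMap.ker L)),
      Submodule.map_comap_subtype]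
  -- `r` independent vectors in `range φ`
  have hrange : Fintype.card r ≤ Module.finrank K ↥(LinearMap.range φ) := by
    let w : r → ↥(LinearMap.range φ) := fun i =>
      ⟨linSubst σ K u₀ (v i) - v i, ⟨⟨v i, (mem_homogeneousSubmodule D _).mpr (hv i)⟩, rfl⟩⟩
    have hw : LinearIndependent K w :=
      LinearIndependent.of_comp (LinearMap.range φ).subtype hli
    exact hw.fintype_card_le_finrank
  omega

/-! ### § 4 Stabilizer elements of a fixed conjugacy type -/

/-- **Conjugating a symmetry to the model.** If `u · f = f` (linear substitution), `P` is invertible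
and `u P = P u₀`, then `f = P · h` for the form `h := P⁻¹ · f` of the same degree, which is fixed by
the model matrix `u₀` (`u₀ = P⁻¹ u P`; reduction of a symmetry to the normal form of its class in
the Matsumura–Monsky count). [cite: Poonen2005, Thm. 3 (proof: dimension count of [MM]; conjugation to
the model of a class)] -/
theorem exists_eq_linSubst_of_mul_eq_mul {D : ℕ} {f : MvPolynomial σ K} (hf : f.IsHomogeneous D)
    {u P u₀ : Matrix σ σ K} (huf : linSubst σ K u f = f) (hP : P.det ≠ 0) (hconj : u * P = P * u₀) :
    ∃ h ∈ homogeneousSubmodule σ K D ⊓ LinearMap.ker ((linSubst σ K u₀).toLinearMap - LinearMap.id),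
      linSubst σ K P h = f := by
  have hPu : IsUnit P.det := isUnit_iff_ne_zero.mpr hP
  refine ⟨linSubst σ K P⁻¹ f, Submodule.mem_inf.mpr ⟨?_, ?_⟩, ?_⟩
  · exact (mem_homogeneousSubmodule D _).mpr (linSubst_isHomogeneous _ hf)
  · rw [LinearMap.mem_ker, LinearMap.sub_apply, LinearMap.id_apply, AlgHom.toLinearMap_apply,
      sub_eq_zero, ← AlgHom.comp_apply, ← linSubst_mul]
    have hu₀ : u₀ * P⁻¹ = P⁻¹ * u := by
      calc u₀ * P⁻¹ = P⁻¹ * (P * u₀) * P⁻¹ := by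
            rw [← Matrix.mul_assoc, Matrix.nonsing_inv_mul _ hPu, Matrix.one_mul]
        _ = P⁻¹ * (u * P) * P⁻¹ := by rw [hconj]
        _ = P⁻¹ * u := by
            rw [Matrix.mul_assoc, Matrix.mul_assoc, Matrix.mul_nonsing_inv _ hPu, Matrix.mul_one]
    rw [hu₀, linSubst_mul, AlgHom.comp_apply, huf]
  · rw [← AlgHom.comp_apply, ← linSubst_mul, Matrix.mul_nonsing_inv _ hPu, linSubst_one,
      AlgHom.id_apply]

/-- **Almost all forms have no symmetry of a given conjugacy type (the Matsumura–Monsky count,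
working form).** Let `G` be a square matrix of polynomials in parameters `ι` (a chart of conjugating
matrices) and `u₀` a model matrix, with `#ι + dim (Sym^D K^σ)^{u₀} < N = #{monomials of degree D}`.
Then for almost all forms `f` of degree `D`, no `u ∈ stab(f)` satisfies `u G(π) = G(π) u₀` with
`det G(π) ≠ 0` — i.e. no stabilizer element is conjugate to `u₀` through the chart. (Matsumura–Monsky:
`dim(class) + dim(fixed forms) < N` ⇒ the generic form has no symmetry in the class.)
[cite: Poonen2005, Thm. 3 (proof: [MM])] -/
theorem isZariskiGeneric_forall_mem_linStabilizer_mul_ne (D : ℕ) {ι : Type*} [Fintype ι]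
    (G : Matrix σ σ (MvPolynomial ι K)) (u₀ : Matrix σ σ K)
    (hcard : Fintype.card ι + Module.finrank K ↥(homogeneousSubmodule σ K D ⊓
        LinearMap.ker ((linSubst σ K u₀).toLinearMap - LinearMap.id)) < (degMonomials σ D).card) :
    IsZariskiGeneric D fun f : MvPolynomial σ K =>
      ∀ u ∈ linStabilizer f, ∀ π : ι → K, (G.map (MvPolynomial.eval π)).det ≠ 0 →
        (u : Matrix σ σ K) * G.map (MvPolynomial.eval π) ≠ G.map (MvPolynomial.eval π) * u₀ := by
  classical
  haveI := finiteDimensional_homogeneousSubmodule σ K D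
  refine (isZariskiGeneric_forall_linSubst_ne_of_finrank D G _ hcard).weaken
    fun f hf hgen u hu π hdet hconj => ?_
  have huf : linSubst σ K (u : Matrix σ σ K) f = f := by
    rw [← linSubstRep_apply]; exact mem_linStabilizer.mp hu
  obtain ⟨h, hh, hfh⟩ := exists_eq_linSubst_of_mul_eq_mul hf huf hdet hconj
  exact hgen π h hh hfh

end FixedForms



end Literature.Computability.AlgebraicComplexity

end
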